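import Literature.NumberTheory.Automorphic.PopaZagierHeckeElementPropertyA
import Literature.NumberTheory.Automorphic.PopaZagierHeckeElementProofs
import Literature.NumberTheory.EllipticCurves.HeckeOnManinSymbolsBoundary
import HarnessLib

/-!
# Popa–Zagier, Theorem 1 (i): the right-coset sums of `T̃_n` are `−1`

For the explicit Hecke element `T̃_n = ∑ c(M) M` of Popa–Zagier (formula (13); here `coeffN n`,
a function on integer matrices with `coeffN n (−M) = coeffN n M`, so that every class `±M` is
counted twice) we prove `⟨T̃_n, K⟩ = ∑_{M ∈ K} c(M) = −1` for every right coset `K = M₀ Γ`,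
`Γ = SL₂(ℤ)`, i.e. `cosetSum (coeffN n) M₀ = ∑_{γ ∈ SL₂(ℤ)} coeffN n (M₀ γ) = −2`
(`cosetSum_coeffN`), and hence `∑_M coeffN n M = −2 σ₁(n)` (`finsum_coeffN`), following the printed
proof:

* (Thm. 2(a)) for `ξ` with property (B), `K ↦ ∑_{M ∈ K} ξ(M)` is invariant under `K ↦ UK` and
  `K ↦ SK`, hence under left multiplication by `SL₂(ℤ) = ⟨S, U⟩` (`cosetSum_coe_mul`);
* every right coset has a left `SL₂(ℤ)`-translate of the form `diag(a, am) Γ` (Hermite and Smith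
  normal forms for `2 × 2` integer matrices, `exists_SL_mul_upper_mul_SL_eq_diag`);
* (Thm. 4(b)) on `K₀ = diag(a, am) Γ` the brackets `T₁ − T₂ = T₁(1 − U)` of (13) cancel, `T₃`
  contributes nothing and `T₄` exactly two matrices of weight `½` when `m ≥ 2` (and `T₃ + T₄`
  has total weight `1` when `m = 1`), by the AM–GM estimates of the printed proof
  (`T34_support`, `T34_values_one`, `T34_values_two`).

## References
* [PopaZagier2017] A. Popa, D. Zagier, *A combinatorial refinement of the Kronecker–Hurwitz class
  number relation*, Proc. AMS 145 (2017), Thm. 1 (i), Thm. 2 (a), Thm. 4 (b).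
-/

noncomputable section

open scoped MatrixGroups
open Matrix ModularGroup
open Literature.NumberTheory.Automorphic.PopaZagier

namespace Literature.NumberTheory.EllipticCurves.ModularForms

/-! ### Right-coset sums and their invariance (Theorem 2 (a)) -/

/-- **The right-coset sum** `⟨ξ, M₀ Γ⟩ = ∑_{γ ∈ SL₂(ℤ)} ξ(M₀ γ)`. [cite: PopaZagier2017, §1 (notation ⟨·,·⟩)] -/
def cosetSum (ξ : Mat → ℚ) (M₀ : Mat) : ℚ := ∑ᶠ γ : SL(2, ℤ), ξ (M₀ * (γ : Mat))

variable {n : ℤ} {ξ : Mat → ℚ}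

/-- `↑(T S) = matU`. [folklore] -/
theorem coe_TS_eq_matU : ((T * S : SL(2, ℤ)) : Mat) = matU := by
  rw [Matrix.SpecialLinearGroup.coe_mul, ModularGroup.coe_T, ModularGroup.coe_S, matU]
  ext i j; fin_cases i <;> fin_cases j <;> rfl

/-- `γ ↦ M₀ γ` is injective when `det M₀ ≠ 0`. [folklore] -/
theorem mul_coe_injective {M₀ : Mat} (hM : M₀.det ≠ 0) :
    Function.Injective fun γ : SL(2, ℤ) => M₀ * (γ : Mat) := by
  intro γ γ' h
  have h' := congrArg (fun X => adjugate M₀ * X) h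
  simp only [← Matrix.mul_assoc, adjugate_mul, smul_mul, Matrix.one_mul] at h'
  exact Subtype.ext (smul_right_injective Mat hM h')

/-- The summands of a right-coset sum are finitely supported (for `ξ` finitely supported on a
fixed nonzero determinant). [folklore] -/
theorem finite_support_cosetFun (hH : HeckeHyp n ξ) (hn : n ≠ 0) (M₀ : Mat) :
    (Function.support fun γ : SL(2, ℤ) => ξ (M₀ * (γ : Mat))).Finite := by
  by_cases hM : M₀.det = n
  · have hinj := mul_coe_injective (M₀ := M₀) (by rw [hM]; exact hn)
    have : (Function.support fun γ : SL(2, ℤ) => ξ (M₀ * (γ : Mat))) =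
        (fun γ : SL(2, ℤ) => M₀ * (γ : Mat)) ⁻¹' Function.support ξ := by ext; simp
    rw [this]
    exact hH.finite.preimage hinj.injOn
  · suffices h : (Function.support fun γ : SL(2, ℤ) => ξ (M₀ * (γ : Mat))) = ∅ by
      rw [h]; exact Set.finite_empty
    ext γ
    simp only [Function.mem_support, ne_eq, Set.mem_empty_iff_false, iff_false, not_not]
    by_contra h
    have := hH.det_eq _ h
    rw [det_mul, Matrix.SpecialLinearGroup.det_coe, mul_one] at this
    exact hM this

/-- Finiteness of a right translate of the summands. [folklore] -/
theorem finite_support_cosetFun_mul (hH : HeckeHyp n ξ) (hn : n ≠ 0) (M₀ : Mat) (γ₁ : SL(2, ℤ)) :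
    (Function.support fun γ : SL(2, ℤ) => ξ (M₀ * (γ : Mat) * (γ₁ : Mat))).Finite := by
  have : (fun γ : SL(2, ℤ) => ξ (M₀ * (γ : Mat) * (γ₁ : Mat))) =
      (fun γ : SL(2, ℤ) => ξ (M₀ * (γ : Mat))) ∘ fun γ => γ * γ₁ := by
    funext γ; simp only [Function.comp_apply, Matrix.SpecialLinearGroup.coe_mul, Matrix.mul_assoc]
  rw [this, Function.support_comp_eq_preimage]
  exact (finite_support_cosetFun hH hn M₀).preimage (mul_left_injective γ₁).injOn

/-- **Right invariance**: `⟨ξ, M₀ γ₀ Γ⟩ = ⟨ξ, M₀ Γ⟩`. [folklore] -/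
theorem cosetSum_mul_coe (ξ : Mat → ℚ) (M₀ : Mat) (γ₀ : SL(2, ℤ)) :
    cosetSum ξ (M₀ * (γ₀ : Mat)) = cosetSum ξ M₀ := by
  unfold cosetSum
  rw [← finsum_comp_equiv (Equiv.mulLeft γ₀) (f := fun γ : SL(2, ℤ) => ξ (M₀ * (γ : Mat)))]
  refine finsum_congr fun γ => ?_
  simp only [Equiv.coe_mulLeft, Matrix.SpecialLinearGroup.coe_mul, Matrix.mul_assoc]

/-- Reindexing a right-coset sum by `γ ↦ γ γ₁`. [folklore] -/
theorem finsum_cosetFun_mul (ξ : Mat → ℚ) (M₀ : Mat) (γ₁ : SL(2, ℤ)) :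
    ∑ᶠ γ : SL(2, ℤ), ξ (M₀ * (γ : Mat) * (γ₁ : Mat)) = ∑ᶠ γ : SL(2, ℤ), ξ (M₀ * (γ : Mat)) := by
  rw [← finsum_comp_equiv (Equiv.mulRight γ₁) (f := fun γ : SL(2, ℤ) => ξ (M₀ * (γ : Mat)))]
  refine finsum_congr fun γ => ?_
  simp only [Equiv.coe_mulRight, Matrix.SpecialLinearGroup.coe_mul, Matrix.mul_assoc]

/-- **`⟨ξ, U K⟩ = ⟨ξ, K⟩`** for `ξ` with property (B): sum `ξ(M) + ξ(MS) = ξ(UM) + ξ(UMS)` over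
`M ∈ K`. [cite: PopaZagier2017, Thm. 2 (a)] -/
theorem cosetSum_matU_mul (hH : HeckeHyp n ξ) (hn : n ≠ 0) (M₀ : Mat) :
    cosetSum ξ (matU * M₀) = cosetSum ξ M₀ := by
  have key : ∀ M₁ : Mat, ∑ᶠ γ : SL(2, ℤ), (ξ (M₁ * (γ : Mat)) + ξ (M₁ * (γ : Mat) * matS)) =
      2 * cosetSum ξ M₁ := fun M₁ => by
    have hfS := finite_support_cosetFun_mul hH hn M₁ S
    rw [coe_S_eq_matS] at hfS
    rw [finsum_add_distrib (finite_support_cosetFun hH hn M₁) hfS, ← coe_S_eq_matS,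
      finsum_cosetFun_mul, cosetSum, two_mul]
  have h1 := key M₀
  have h2 := key (matU * M₀)
  have h12 : ∑ᶠ γ : SL(2, ℤ), (ξ (M₀ * (γ : Mat)) + ξ (M₀ * (γ : Mat) * matS)) =
      ∑ᶠ γ : SL(2, ℤ), (ξ (matU * M₀ * (γ : Mat)) + ξ (matU * M₀ * (γ : Mat) * matS)) :=
    finsum_congr fun γ => by simpa only [Matrix.mul_assoc] using hH.propB1 (M₀ * (γ : Mat))
  have : 2 * cosetSum ξ (matU * M₀) = 2 * cosetSum ξ M₀ := by rw [← h1, ← h2, h12]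
  linarith

/-- **`⟨ξ, S K⟩ = ⟨ξ, K⟩`** for `ξ` with property (B): sum
`ξ(M) + ξ(MU) + ξ(MU²) = ξ(SM) + ξ(SMU) + ξ(SMU²)` over `M ∈ K`. [cite: PopaZagier2017, Thm. 2 (a)] -/
theorem cosetSum_matS_mul (hH : HeckeHyp n ξ) (hn : n ≠ 0) (M₀ : Mat) :
    cosetSum ξ (matS * M₀) = cosetSum ξ M₀ := by
  have key : ∀ M₁ : Mat, ∑ᶠ γ : SL(2, ℤ),
      (ξ (M₁ * (γ : Mat)) + ξ (M₁ * (γ : Mat) * matU) + ξ (M₁ * (γ : Mat) * matU * matU)) =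
      3 * cosetSum ξ M₁ := fun M₁ => by
    have hfU := finite_support_cosetFun_mul hH hn M₁ (T * S)
    have hfUU := finite_support_cosetFun_mul hH hn M₁ (T * S * (T * S))
    rw [coe_TS_eq_matU] at hfU
    rw [Matrix.SpecialLinearGroup.coe_mul, coe_TS_eq_matU] at hfUU
    simp only [← Matrix.mul_assoc] at hfUU
    have hfUU' : (Function.support fun γ : SL(2, ℤ) => ξ (M₁ * (γ : Mat) * matU * matU)).Finite := by
      convert hfUU using 3
    rw [finsum_add_distrib ((finite_support_cosetFun hH hn M₁).union hfU |>.subset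
        (Function.support_add _ _)) hfUU',
      finsum_add_distrib (finite_support_cosetFun hH hn M₁) hfU]
    have e1 : ∑ᶠ γ : SL(2, ℤ), ξ (M₁ * (γ : Mat) * matU) = cosetSum ξ M₁ := by
      rw [← coe_TS_eq_matU, finsum_cosetFun_mul, cosetSum]
    have e2 : ∑ᶠ γ : SL(2, ℤ), ξ (M₁ * (γ : Mat) * matU * matU) = cosetSum ξ M₁ := by
      have := finsum_cosetFun_mul ξ M₁ (T * S * (T * S))
      rw [Matrix.SpecialLinearGroup.coe_mul, coe_TS_eq_matU] at this
      simp only [← Matrix.mul_assoc] at this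
      rw [cosetSum, ← this]
    rw [e1, e2, cosetSum]; ring
  have h1 := key M₀
  have h2 := key (matS * M₀)
  have h12 : ∑ᶠ γ : SL(2, ℤ),
      (ξ (M₀ * (γ : Mat)) + ξ (M₀ * (γ : Mat) * matU) + ξ (M₀ * (γ : Mat) * matU * matU)) =
      ∑ᶠ γ : SL(2, ℤ), (ξ (matS * M₀ * (γ : Mat)) + ξ (matS * M₀ * (γ : Mat) * matU) +
        ξ (matS * M₀ * (γ : Mat) * matU * matU)) :=
    finsum_congr fun γ => by simpa only [Matrix.mul_assoc] using hH.propB2 (M₀ * (γ : Mat))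
  have : 3 * cosetSum ξ (matS * M₀) = 3 * cosetSum ξ M₀ := by rw [← h1, ← h2, h12]
  linarith

/-- **Theorem 2 (a)**: `⟨ξ, g K⟩ = ⟨ξ, K⟩` for all `g ∈ SL₂(ℤ) = ⟨S, T⟩` (`T = (TS) S⁻¹`).
[cite: PopaZagier2017, Thm. 2 (a)] -/
theorem cosetSum_coe_mul (hH : HeckeHyp n ξ) (hn : n ≠ 0) (g : SL(2, ℤ)) (M₀ : Mat) :
    cosetSum ξ ((g : Mat) * M₀) = cosetSum ξ M₀ := by
  let K : Subgroup SL(2, ℤ) :=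
    { carrier := {g | ∀ M₀ : Mat, cosetSum ξ ((g : Mat) * M₀) = cosetSum ξ M₀}
      mul_mem' := fun {a b} ha hb M₀ => by
        show cosetSum ξ (((a * b : SL(2, ℤ)) : Mat) * M₀) = cosetSum ξ M₀
        rw [Matrix.SpecialLinearGroup.coe_mul, Matrix.mul_assoc, ha, hb]
      one_mem' := fun M₀ => by
        show cosetSum ξ (((1 : SL(2, ℤ)) : Mat) * M₀) = cosetSum ξ M₀
        rw [Matrix.SpecialLinearGroup.coe_one, Matrix.one_mul]
      inv_mem' := fun {a} ha M₀ => by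
        show cosetSum ξ (((a⁻¹ : SL(2, ℤ)) : Mat) * M₀) = cosetSum ξ M₀
        rw [← ha (((a⁻¹ : SL(2, ℤ)) : Mat) * M₀), ← Matrix.mul_assoc, ← Matrix.SpecialLinearGroup.coe_mul,
          mul_inv_cancel, Matrix.SpecialLinearGroup.coe_one, Matrix.one_mul] }
  have hSK : S ∈ K := fun M₀ => by
    show cosetSum ξ (((S : SL(2, ℤ)) : Mat) * M₀) = cosetSum ξ M₀
    rw [coe_S_eq_matS, cosetSum_matS_mul hH hn]
  have hTSK : T * S ∈ K := fun M₀ => by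
    show cosetSum ξ (((T * S : SL(2, ℤ)) : Mat) * M₀) = cosetSum ξ M₀
    rw [coe_TS_eq_matU, cosetSum_matU_mul hH hn]
  have hTK : T ∈ K := by
    have : T = T * S * S⁻¹ := by group
    rw [this]
    exact K.mul_mem hTSK (K.inv_mem hSK)
  have hK : K = ⊤ := by
    rw [eq_top_iff, ← SpecialLinearGroup.SL2Z_generators, Subgroup.closure_le]
    rintro g (rfl | rfl)
    · exact hSK
    · exact hTK
  have hg : g ∈ K := hK ▸ Subgroup.mem_top g
  exact hg M₀

/-! ### Smith normal form for `2 × 2` upper-triangular integer matrices -/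

/-- Euclid step (a): `(x y; -d₁ a₁) · diag(g a₁, g d₁) · (1 0; 1 1) = (g, y d; 0, a₁ d)` when
`a₁ x + d₁ y = 1`. [folklore] -/
theorem smith_stepA {g a₁ d₁ x y : ℤ} (hbez : a₁ * x + d₁ * y = 1) :
    !![x, y; -d₁, a₁] * (!![g * a₁, 0; 0, g * d₁] * !![1, 0; 1, 1]) =
      (!![g, y * (g * d₁); 0, a₁ * (g * d₁)] : Mat) := by
  ext i j; fin_cases i <;> fin_cases j <;> simp [Matrix.mul_apply, Fin.sum_univ_two]
  all_goals first | ring1 | linear_combination g * hbez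

/-- Euclid step (b₁): `(g a₁, g b₁; 0, d) · (x, -b₁; z, a₁) = (g, 0; d z, a₁ d)` when
`a₁ x + b₁ z = 1`. [folklore] -/
theorem smith_stepB1 {g a₁ b₁ d x z : ℤ} (hbez : a₁ * x + b₁ * z = 1) :
    (!![g * a₁, g * b₁; 0, d] * !![x, -b₁; z, a₁] : Mat) = !![g, 0; d * z, a₁ * d] := by
  ext i j; fin_cases i <;> fin_cases j <;> simp [Matrix.mul_apply, Fin.sum_univ_two]
  all_goals first | ring1 | linear_combination g * hbez

/-- Euclid step (b₂): `(x', y'; -e, g') · (g₃ g', 0; g₃ e, f) = (g₃, y' f; 0, g' f)` when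
`g' x' + e y' = 1`. [folklore] -/
theorem smith_stepB2 {g₃ g' e f x' y' : ℤ} (hbez : g' * x' + e * y' = 1) :
    (!![x', y'; -e, g'] * !![g₃ * g', 0; g₃ * e, f] : Mat) = !![g₃, y' * f; 0, g' * f] := by
  ext i j; fin_cases i <;> fin_cases j <;> simp [Matrix.mul_apply, Fin.sum_univ_two]
  all_goals first | ring1 | linear_combination g₃ * hbez

/-- `gcd(a, b) < a` when `0 < a` and `a ∤ b`; also the cofactor decomposition. [folklore] -/
theorem gcd_lt_of_not_dvd {a b : ℤ} (ha : 0 < a) (hab : ¬ a ∣ b) :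
    0 < (Int.gcd a b : ℤ) ∧ (Int.gcd a b : ℤ) < a := by
  have hg0 : 0 < (Int.gcd a b : ℤ) := by exact_mod_cast Int.gcd_pos_of_ne_zero_left b ha.ne'
  refine ⟨hg0, ?_⟩
  rcases (Int.le_of_dvd ha (Int.gcd_dvd_left a b)).lt_or_eq with h | h
  · exact h
  · exact absurd (h ▸ Int.gcd_dvd_right a b) hab

/-- Bezout in cofactor form: if `g = gcd(a, b) > 0`, `a = g a₁`, `b = g b₁` then
`a₁ · gcdA + b₁ · gcdB = 1`. [folklore] -/
theorem bezout_cofactor {g a b a₁ b₁ : ℤ} (hg : g = Int.gcd a b) (ha : a = g * a₁) (hb : b = g * b₁)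
    (hg0 : 0 < g) : a₁ * Int.gcdA a b + b₁ * Int.gcdB a b = 1 := by
  have h := Int.gcd_eq_gcd_ab a b
  generalize Int.gcdA a b = A at h ⊢
  generalize Int.gcdB a b = B at h ⊢
  rw [← hg, ha, hb] at h
  have h' : g * (a₁ * A + b₁ * B - 1) = 0 := by linear_combination -h
  rcases mul_eq_zero.mp h' with h0 | h0
  · omega
  · linarith

/-- **Smith normal form** (`2 × 2`, upper triangular with positive diagonal): there are
`γ, γ' ∈ SL₂(ℤ)` and `a', m > 0` with `γ (a b; 0 d) γ' = diag(a', a' m)` (Euclid on the top-left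
entry). [folklore] -/
theorem exists_SL_mul_upper_mul_SL_eq_diag :
    ∀ (k : ℕ) (a b d : ℤ), 0 < a → a.toNat = k → 0 < d →
      ∃ (γ γ' : SL(2, ℤ)) (a' m : ℤ), 0 < a' ∧ 0 < m ∧
        (γ : Mat) * !![a, b; 0, d] * (γ' : Mat) = !![a', 0; 0, a' * m] := by
  intro k
  induction k using Nat.strong_induction_on with
  | _ k IH =>
  intro a b d ha hk hd
  -- continuing the induction from a partial reduction `δ A δ' = (g, b'; 0, d')` with `0 < g < a`
  have step : ∀ g b' d' : ℤ, 0 < g → g < a → 0 < d' →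
      ∀ (δ δ' : SL(2, ℤ)), (δ : Mat) * !![a, b; 0, d] * (δ' : Mat) = !![g, b'; 0, d'] →
      ∃ (γ γ' : SL(2, ℤ)) (a' m : ℤ), 0 < a' ∧ 0 < m ∧
        (γ : Mat) * !![a, b; 0, d] * (γ' : Mat) = !![a', 0; 0, a' * m] := by
    intro g b' d' hg hga hd' δ δ' hδ
    obtain ⟨γ, γ', a', m, ha', hm, h⟩ := IH g.toNat (by omega) g b' d' hg rfl hd'
    refine ⟨γ * δ, δ' * γ', a', m, ha', hm, ?_⟩
    rw [Matrix.SpecialLinearGroup.coe_mul, Matrix.SpecialLinearGroup.coe_mul, ← h, ← hδ]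
    simp only [Matrix.mul_assoc]
  by_cases hab : a ∣ b
  · obtain ⟨q, rfl⟩ := hab
    -- clear the top-right entry
    let τ : SL(2, ℤ) := ⟨!![1, -q; 0, 1], by rw [Matrix.det_fin_two_of]; ring⟩
    have hτ : (τ : Mat) = !![1, -q; 0, 1] := rfl
    have h1 : (!![a, a * q; 0, d] * (τ : Mat) : Mat) = !![a, 0; 0, d] := by
      rw [hτ]
      ext i j; fin_cases i <;> fin_cases j <;> simp [Matrix.mul_apply, Fin.sum_univ_two]
    by_cases had : a ∣ d
    · obtain ⟨m, rfl⟩ := had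
      refine ⟨1, τ, a, m, ha, by nlinarith, ?_⟩
      rw [Matrix.SpecialLinearGroup.coe_one, Matrix.one_mul, h1]
    · obtain ⟨hg0, hglt⟩ := gcd_lt_of_not_dvd ha had
      set g : ℤ := (Int.gcd a d : ℤ) with hg
      obtain ⟨a₁, ha₁⟩ : g ∣ a := Int.gcd_dvd_left a d
      obtain ⟨d₁, hd₁⟩ : g ∣ d := Int.gcd_dvd_right a d
      have ha₁0 : 0 < a₁ := by nlinarith
      have hbez := bezout_cofactor hg ha₁ hd₁ hg0
      let P : SL(2, ℤ) := ⟨!![1, 0; 1, 1], by rw [Matrix.det_fin_two_of]; ring⟩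
      have hP : (P : Mat) = !![1, 0; 1, 1] := rfl
      let δ : SL(2, ℤ) := ⟨!![Int.gcdA a d, Int.gcdB a d; -d₁, a₁], by
        rw [Matrix.det_fin_two_of]; linear_combination hbez⟩
      have hδ : (δ : Mat) = !![Int.gcdA a d, Int.gcdB a d; -d₁, a₁] := rfl
      refine step g (Int.gcdB a d * d) (a₁ * d) hg0 hglt (mul_pos ha₁0 hd) δ (τ * P) ?_
      rw [Matrix.SpecialLinearGroup.coe_mul, Matrix.mul_assoc, ← Matrix.mul_assoc (!![a, a * q; 0, d] : Mat),
        h1, hδ, hP]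
      have e := smith_stepA (g := g) hbez
      rw [← ha₁, ← hd₁] at e
      exact e
  · obtain ⟨hg0, hglt⟩ := gcd_lt_of_not_dvd ha hab
    set g : ℤ := (Int.gcd a b : ℤ) with hg
    obtain ⟨a₁, ha₁⟩ : g ∣ a := Int.gcd_dvd_left a b
    obtain ⟨b₁, hb₁⟩ : g ∣ b := Int.gcd_dvd_right a b
    have ha₁0 : 0 < a₁ := by nlinarith
    have hbez := bezout_cofactor hg ha₁ hb₁ hg0
    let δ' : SL(2, ℤ) := ⟨!![Int.gcdA a b, -b₁; Int.gcdB a b, a₁], by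
      rw [Matrix.det_fin_two_of]; linear_combination hbez⟩
    have hδ' : (δ' : Mat) = !![Int.gcdA a b, -b₁; Int.gcdB a b, a₁] := rfl
    have h1 : (!![a, b; 0, d] * (δ' : Mat) : Mat) = !![g, 0; d * Int.gcdB a b, a₁ * d] := by
      rw [hδ']
      have e := smith_stepB1 (g := g) (d := d) hbez
      rw [← ha₁, ← hb₁] at e
      exact e
    -- second Euclid step on the first column `(g, d z)`
    set z := Int.gcdB a b with hz
    by_cases hdz : g ∣ d * z
    · obtain ⟨e, he⟩ := hdz
      let δ : SL(2, ℤ) := ⟨!![1, 0; -e, 1], by rw [Matrix.det_fin_two_of]; ring⟩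
      have hδ : (δ : Mat) = !![1, 0; -e, 1] := rfl
      refine step g 0 (a₁ * d) hg0 hglt (mul_pos ha₁0 hd) δ δ' ?_
      rw [Matrix.mul_assoc, h1, hδ, he]
      ext i j; fin_cases i <;> fin_cases j <;> simp [Matrix.mul_apply, Fin.sum_univ_two]
      all_goals ring
    · obtain ⟨hg3, hg3lt⟩ := gcd_lt_of_not_dvd hg0 hdz
      set g₃ : ℤ := (Int.gcd g (d * z) : ℤ) with hg₃
      obtain ⟨g', hg'⟩ : g₃ ∣ g := Int.gcd_dvd_left g (d * z)
      obtain ⟨e, he⟩ : g₃ ∣ d * z := Int.gcd_dvd_right g (d * z)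
      have hbez2 := bezout_cofactor hg₃ hg' he hg3
      let δ : SL(2, ℤ) := ⟨!![Int.gcdA g (d * z), Int.gcdB g (d * z); -e, g'], by
        rw [Matrix.det_fin_two_of]; linear_combination hbez2⟩
      have hδ : (δ : Mat) = !![Int.gcdA g (d * z), Int.gcdB g (d * z); -e, g'] := rfl
      refine step g₃ (Int.gcdB g (d * z) * (a₁ * d)) (g' * (a₁ * d)) hg3 (by omega)
        (mul_pos (by nlinarith) (mul_pos ha₁0 hd)) δ δ' ?_
      rw [Matrix.mul_assoc, h1, hδ]
      have e2 := smith_stepB2 (g₃ := g₃) (f := a₁ * d) hbez2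
      rw [← hg', ← he] at e2
      exact e2

/-- **Every integer matrix of positive determinant is `γ · diag(a, am) · γ'`** with
`γ, γ' ∈ SL₂(ℤ)`, `a, m > 0` (Hermite then Smith normal form). [folklore] -/
theorem exists_SL_mul_diag_mul_SL {n : ℤ} (hn : 0 < n) {M : Mat} (hM : M.det = n) :
    ∃ (γ γ' : SL(2, ℤ)) (a m : ℤ), 0 < a ∧ 0 < m ∧ M = (γ : Mat) * !![a, 0; 0, a * m] * (γ' : Mat) := by
  obtain ⟨⟨h, C⟩, hC, hhC⟩ := exists_SL_mul_mem_hermiteReps hn M hM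
  obtain ⟨hc0, ha, -, -, hdet⟩ := (mem_hermiteReps hn C).mp hC
  have hd : 0 < C 1 1 := by
    rw [Matrix.det_fin_two, hc0, mul_zero, sub_zero] at hdet
    nlinarith
  obtain ⟨γ, γ', a', m, ha', hm, hγ⟩ :=
    exists_SL_mul_upper_mul_SL_eq_diag _ (C 0 0) (C 0 1) (C 1 1) ha rfl hd
  have hCe : C = !![C 0 0, C 0 1; 0, C 1 1] := by
    ext i j; fin_cases i <;> fin_cases j <;> simp [hc0]
  have hC' : C = ((γ⁻¹ : SL(2, ℤ)) : Mat) * !![a', 0; 0, a' * m] * ((γ'⁻¹ : SL(2, ℤ)) : Mat) := by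
    rw [← hγ, ← hCe]
    simp only [← Matrix.mul_assoc, ← Matrix.SpecialLinearGroup.coe_mul, inv_mul_cancel,
      Matrix.SpecialLinearGroup.coe_one, Matrix.one_mul]
    rw [Matrix.mul_assoc, ← Matrix.SpecialLinearGroup.coe_mul, mul_inv_cancel,
      Matrix.SpecialLinearGroup.coe_one, Matrix.mul_one]
  refine ⟨h * γ⁻¹, γ'⁻¹, a', m, ha', hm, ?_⟩
  rw [← hhC, Matrix.SpecialLinearGroup.coe_mul, hC']
  simp only [Matrix.mul_assoc]

/-! ### Theorem 4 (b): `⟨T̃_n, diag(a, am) Γ⟩ = −1` -/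

section Evaluation

/-- On the right coset `diag(a, am) SL₂(ℤ)` (`a, m > 0`), the brackets `T₃`, `T₄` of (13) are
supported on `γ ∈ {(0 -1; 1 0), (1 -1; 1 0), (0 -1; 1 -1)}` (Popa–Zagier 2017, proof of
Thm. 4(b): the AM–GM estimates `m ≥ m²c²`, `m ≥ ¾ m²d²`). [cite: PopaZagier2017, Thm. 4(b) (proof)] -/
theorem T34_support {a m x y z w : ℤ} (ha : 0 < a) (hm : 0 < m) (hdet : x * w - y * z = 1)
    (h : wT3 (a * x) (a * y) (a * m * z) (a * m * w) ≠ 0 ∨ wT4 (a * x) (a * y) (a * m * z) (a * m * w) ≠ 0) :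
    (x = 0 ∧ y = -1 ∧ z = 1 ∧ w = 0) ∨ (x = 1 ∧ y = -1 ∧ z = 1 ∧ w = 0) ∨
      (x = 0 ∧ y = -1 ∧ z = 1 ∧ w = -1) := by
  have ham : 0 < a * m := mul_pos ha hm
  rcases h with h | h
  · -- `T₃ = ⟨0 ≤ a-d ≤ c ≤ -b | a ≤ 0 < c⟩`
    obtain ⟨h1, h2, h3, h4, h5⟩ := wT3_ne_zero h
    have hx : x ≤ 0 := by nlinarith
    have hz : 0 < z := by nlinarith
    have hxw : 0 ≤ x - m * w := by nlinarith
    have hle1 : x - m * w ≤ m * z := by nlinarith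
    have hle2 : m * z ≤ -y := by nlinarith
    have hw : w ≤ 0 := by nlinarith
    have hxw0 : 0 ≤ x * w := by nlinarith
    have hyz : m * (z * z) ≤ -y * z := by nlinarith
    have hzz : z ≤ z * z := by nlinarith
    have hm1 : m = 1 := by nlinarith
    subst hm1
    have hz1 : z = 1 := by nlinarith
    subst hz1
    have hxw1 : x * w = 0 := by nlinarith
    have hy : y = -1 := by nlinarith
    subst hy
    rcases mul_eq_zero.mp hxw1 with hx0 | hw0
    · subst hx0
      have : w = 0 ∨ w = -1 := by omega
      rcases this with rfl | rfl
      · exact Or.inl ⟨rfl, rfl, rfl, rfl⟩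
      · exact Or.inr (Or.inr ⟨rfl, rfl, rfl, rfl⟩)
    · subst hw0
      have hx0 : x = 0 := by omega
      subst hx0
      exact Or.inl ⟨rfl, rfl, rfl, rfl⟩
  · -- `T₄ = ⟨0 ≤ a-d ≤ -b ≤ c | d ≤ 0 < -b⟩`
    obtain ⟨h1, h2, h3, h4, h5⟩ := wT4_ne_zero h
    have hw : w ≤ 0 := by nlinarith
    have hy : y < 0 := by nlinarith
    have hxw : 0 ≤ x - m * w := by nlinarith
    have hle1 : x - m * w ≤ -y := by nlinarith
    have hle2 : -y ≤ m * z := by nlinarith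
    have hz : 0 < z := by nlinarith
    -- `m = (mz)(-y) + (mw)(x - mw) + m²w²` with `(mz)(-y) ≥ y²`, `(mw)(x-mw) ≥ (mw)(-y)`
    have e1 : m * z * (-y) ≥ y * y := by nlinarith
    have e2 : m * w * (x - m * w) ≥ m * w * (-y) := by nlinarith
    have hm' : m * (x * w) - m * (y * z) = m := by linear_combination m * hdet
    have key : m ≥ y * y - m * w * y + m * m * (w * w) := by nlinarith
    by_cases hw0 : w = 0
    · subst hw0
      have hyz : -y * z = 1 := by nlinarith
      have hy1 : y = -1 := by nlinarith
      subst hy1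
      have hz1 : z = 1 := by omega
      subst hz1
      have : x = 0 ∨ x = 1 := by omega
      rcases this with rfl | rfl
      · exact Or.inl ⟨rfl, rfl, rfl, rfl⟩
      · exact Or.inr (Or.inl ⟨rfl, rfl, rfl, rfl⟩)
    · have hw1 : w ≤ -1 := by omega
      -- `y² + m w y + m² w² ≥ ¾ m² w² ≥ ¾ m²`, so `m ≤ 1`
      have hq : 4 * (y * y - m * w * y + m * m * (w * w)) ≥ 3 * (m * m) * (w * w) := by
        nlinarith [sq_nonneg (2 * y - m * w)]
      have hww : 1 ≤ w * w := by nlinarith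
      have hm1 : m = 1 := by nlinarith
      subst hm1
      have hyw1 : 1 ≤ y * w := by nlinarith
      have hyw : y = w := by nlinarith [sq_nonneg (y - w)]
      subst hyw
      have hy1 : y = -1 := by nlinarith
      subst hy1
      have hzx : z = x + 1 := by nlinarith
      subst hzx
      have hx0 : x = 0 := by omega
      subst hx0
      exact Or.inr (Or.inr ⟨rfl, rfl, rfl, rfl⟩)

/-- Values of `T₃`, `T₄` at the three matrices of the coset `diag(a, a) SL₂(ℤ)` (`m = 1`):
total weight `12`. [cite: PopaZagier2017, Thm. 4(b) (proof)] -/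
theorem T34_values_one {a : ℤ} (ha : 0 < a) :
    wT3 0 (-a) a 0 = 3 ∧ wT4 0 (-a) a 0 = 3 ∧ wT3 a (-a) a 0 = 0 ∧ wT4 a (-a) a 0 = 2 ∧
      wT3 0 (-a) a (-a) = 2 ∧ wT4 0 (-a) a (-a) = 2 := by
  refine ⟨?_, ?_, ?_, ?_, ?_, ?_⟩ <;>
  · simp only [wT3, wT4, chainWeight4]
    split_ifs <;> omega

/-- Values of `T₃`, `T₄` at the three matrices of the coset `diag(a, k) SL₂(ℤ)`, `k = am > a`
(`m ≥ 2`): total weight `12`. [cite: PopaZagier2017, Thm. 4(b) (proof)] -/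
theorem T34_values_two {a k : ℤ} (ha : 0 < a) (hk : a < k) :
    wT3 0 (-a) k 0 = 0 ∧ wT4 0 (-a) k 0 = 6 ∧ wT3 a (-a) k 0 = 0 ∧ wT4 a (-a) k 0 = 6 ∧
      wT3 0 (-a) k (-k) = 0 ∧ wT4 0 (-a) k (-k) = 0 := by
  refine ⟨?_, ?_, ?_, ?_, ?_, ?_⟩ <;>
  · simp only [wT3, wT4, chainWeight4]
    split_ifs <;> omega


/-- `pz13` is supported on sign-normalised matrices. [folklore] -/
theorem pz13_eq_zero_of_not_norm {a b c d : ℤ} (h : ¬ (0 < c ∨ (c = 0 ∧ 0 < a))) : pz13 a b c d = 0 := by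
  rw [pz13_eq]
  have h1 : wT1 a b c d = 0 := by by_contra h'; have := wT1_ne_zero h'; omega
  have h2 : wT2 a b c d = 0 := by by_contra h'; have := wT2_ne_zero h'; omega
  have h3 : wT3 a b c d = 0 := by by_contra h'; have := wT3_ne_zero h'; omega
  have h4 : wT4 a b c d = 0 := by by_contra h'; have := wT4_ne_zero h'; omega
  rw [h1, h2, h3, h4]; rfl

/-- `coeff12 = pz13(M) + pz13(−M)` (at most one of `M`, `−M` is sign-normalised). [folklore] -/
theorem coeff12_eq_pz13_add (a b c d : ℤ) :
    coeff12 a b c d = pz13 a b c d + pz13 (-a) (-b) (-c) (-d) := by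
  unfold coeff12
  split_ifs with hs
  · rw [pz13_eq_zero_of_not_norm (a := -a) (c := -c) (by omega), add_zero]
  · rw [pz13_eq_zero_of_not_norm hs, zero_add]

/-- `sgnNorm w = w(M) + w(−M)` for a bracket weight `w` supported on sign-normalised matrices.
[folklore] -/
theorem sgnNorm_eq_add {w : ℤ → ℤ → ℤ → ℤ → ℤ} (hw : ∀ a b c d, w a b c d ≠ 0 → (0 < c ∨ (c = 0 ∧ 0 < a)))
    (a b c d : ℤ) :
    sgnNorm w a b c d = w a b c d + w (-a) (-b) (-c) (-d) := by
  unfold sgnNorm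
  split_ifs with hs
  · have : w (-a) (-b) (-c) (-d) = 0 := by
      by_contra h'; have := hw _ _ _ _ h'; omega
    rw [this, add_zero]
  · have : w a b c d = 0 := by
      by_contra h'; have := hw _ _ _ _ h'; omega
    rw [this, zero_add]

/-- `T₁` is supported on sign-normalised matrices. [folklore] -/
theorem norm_of_wT1_ne_zero (a b c d : ℤ) (h : wT1 a b c d ≠ 0) : 0 < c ∨ (c = 0 ∧ 0 < a) := by
  have := wT1_ne_zero h; omega

/-- `T₂` is supported on sign-normalised matrices. [folklore] -/
theorem norm_of_wT2_ne_zero (a b c d : ℤ) (h : wT2 a b c d ≠ 0) : 0 < c ∨ (c = 0 ∧ 0 < a) := by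
  have := wT2_ne_zero h; omega

/-- The elements of `SL₂(ℤ)` with entries bounded by `B` form a finite set. [folklore] -/
theorem finite_SL_abs_le (B : ℤ) : {γ : SL(2, ℤ) | ∀ i j, |(γ : Mat) i j| ≤ B}.Finite := by
  classical
  let box : Finset ℤ := Finset.Icc (-B) B
  let F : Finset Mat := (box ×ˢ box ×ˢ box ×ˢ box).image fun p => !![p.1, p.2.1; p.2.2.1, p.2.2.2]
  have hF : {M : Mat | ∀ i j, |M i j| ≤ B} ⊆ (F : Set Mat) := by
    intro M hM
    simp only [Finset.coe_image, Set.mem_image, Finset.mem_coe, Finset.mem_product, Finset.mem_Icc,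
      Prod.exists, F, box]
    refine ⟨M 0 0, M 0 1, M 1 0, M 1 1, ⟨abs_le.mp (hM 0 0), abs_le.mp (hM 0 1), abs_le.mp (hM 1 0),
      abs_le.mp (hM 1 1)⟩, ?_⟩
    ext i j; fin_cases i <;> fin_cases j <;> rfl
  have : {γ : SL(2, ℤ) | ∀ i j, |(γ : Mat) i j| ≤ B} =
      (fun γ : SL(2, ℤ) => (γ : Mat)) ⁻¹' {M : Mat | ∀ i j, |M i j| ≤ B} := by ext; simp
  rw [this]
  exact (F.finite_toSet.subset hF).preimage Subtype.coe_injective.injOn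

variable {a m : ℤ}

/-- `|x| ≤ |a x|` for `a ≥ 1`. [folklore] -/
theorem abs_le_abs_mul {a : ℤ} (ha : 0 < a) (x : ℤ) : |x| ≤ |a * x| := by
  rw [abs_mul, abs_of_pos ha]; exact le_mul_of_one_le_left (abs_nonneg x) ha

/-- Entry bound on the coset `diag(a, am) SL₂(ℤ)`: if the entries of `±diag(a, am) γ` are bounded
by its determinant then the entries of `γ` are bounded by `a (am)`. [folklore] -/
theorem entries_le_of_bounds (ha : 0 < a) (hm : 0 < m) (γ : SL(2, ℤ)) {ε : ℤ} (hε : ε = 1 ∨ ε = -1)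
    (h : |ε * (a * (γ : Mat) 0 0)| ≤ a * (a * m) ∧ |ε * (a * (γ : Mat) 0 1)| ≤ a * (a * m) ∧
      |ε * (a * m * (γ : Mat) 1 0)| ≤ a * (a * m) ∧ |ε * (a * m * (γ : Mat) 1 1)| ≤ a * (a * m)) :
    ∀ i j, |(γ : Mat) i j| ≤ a * (a * m) := by
  have ham : 0 < a * m := mul_pos ha hm
  have hε1 : ∀ t : ℤ, |ε * t| = |t| := fun t => by rcases hε with rfl | rfl <;> simp
  simp only [hε1] at h
  obtain ⟨h1, h2, h3, h4⟩ := h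
  intro i j
  fin_cases i <;> fin_cases j
  · exact (abs_le_abs_mul ha _).trans h1
  · exact (abs_le_abs_mul ha _).trans h2
  · exact (abs_le_abs_mul ham _).trans h3
  · exact (abs_le_abs_mul ham _).trans h4

/-- The determinant of `ε · diag(a, am) γ` in entry form. [folklore] -/
theorem det_coset_entries (a m : ℤ) (γ : SL(2, ℤ)) (ε : ℤ) (hε : ε = 1 ∨ ε = -1) :
    ε * (a * (γ : Mat) 0 0) * (ε * (a * m * (γ : Mat) 1 1)) -
      ε * (a * (γ : Mat) 0 1) * (ε * (a * m * (γ : Mat) 1 0)) = a * (a * m) := by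
  have hdet := γ.det_coe
  rw [Matrix.det_fin_two] at hdet
  have hε2 : ε * ε = 1 := by rcases hε with rfl | rfl <;> norm_num
  linear_combination (a * (a * m)) * hdet + (a * a * m * ((γ : Mat) 0 0 * (γ : Mat) 1 1 - (γ : Mat) 0 1 * (γ : Mat) 1 0)) * hε2

/-- Support bound for the bracket weights on the coset: if a weight with Lemma-4(a)-type entry
bounds is nonzero at `ε · diag(a, am) γ` then `γ` has entries bounded by `a (am)`. [folklore] -/
theorem mem_bounded_of_ne_zero (ha : 0 < a) (hm : 0 < m) {w : ℤ → ℤ → ℤ → ℤ → ℤ}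
    (hw : ∀ p q r s, w p q r s ≠ 0 →
      0 < p * s - q * r ∧ |p| ≤ p * s - q * r ∧ |q| ≤ p * s - q * r ∧ |r| ≤ p * s - q * r ∧ |s| ≤ p * s - q * r)
    {ε : ℤ} (hε : ε = 1 ∨ ε = -1) (γ : SL(2, ℤ))
    (h : w (ε * (a * (γ : Mat) 0 0)) (ε * (a * (γ : Mat) 0 1)) (ε * (a * m * (γ : Mat) 1 0))
      (ε * (a * m * (γ : Mat) 1 1)) ≠ 0) :
    γ ∈ {γ : SL(2, ℤ) | ∀ i j, |(γ : Mat) i j| ≤ a * (a * m)} := by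
  obtain ⟨-, h1, h2, h3, h4⟩ := hw _ _ _ _ h
  rw [det_coset_entries a m γ ε hε] at h1 h2 h3 h4
  exact entries_le_of_bounds ha hm γ hε ⟨h1, h2, h3, h4⟩

/-- The weight of `γ ↦ w(ε diag(a, am) γ)` as a function on `SL₂(ℤ)`. [folklore] -/
def cosetW (w : ℤ → ℤ → ℤ → ℤ → ℤ) (a m ε : ℤ) (γ : SL(2, ℤ)) : ℤ :=
  w (ε * (a * (γ : Mat) 0 0)) (ε * (a * (γ : Mat) 0 1)) (ε * (a * m * (γ : Mat) 1 0)) (ε * (a * m * (γ : Mat) 1 1))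

/-- Finiteness of the support of `cosetW w a m ε` for a weight with Lemma-4(a) bounds. [folklore] -/
theorem finite_support_cosetW (ha : 0 < a) (hm : 0 < m) {w : ℤ → ℤ → ℤ → ℤ → ℤ}
    (hw : ∀ p q r s, w p q r s ≠ 0 →
      0 < p * s - q * r ∧ |p| ≤ p * s - q * r ∧ |q| ≤ p * s - q * r ∧ |r| ≤ p * s - q * r ∧ |s| ≤ p * s - q * r)
    {ε : ℤ} (hε : ε = 1 ∨ ε = -1) : (Function.support (cosetW w a m ε)).Finite :=
  (finite_SL_abs_le (a * (a * m))).subset fun γ hγ => mem_bounded_of_ne_zero ha hm hw hε γ hγ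

/-- Reindexing by `γ ↦ −γ` exchanges `ε` and `−ε`. [folklore] -/
theorem finsum_cosetW_neg (w : ℤ → ℤ → ℤ → ℤ → ℤ) (a m : ℤ) :
    ∑ᶠ γ : SL(2, ℤ), cosetW w a m (-1) γ = ∑ᶠ γ : SL(2, ℤ), cosetW w a m 1 γ := by
  rw [← finsum_comp_equiv (Equiv.neg SL(2, ℤ)) (f := cosetW w a m 1)]
  refine finsum_congr fun γ => ?_
  simp only [cosetW, Equiv.neg_apply, Matrix.SpecialLinearGroup.coe_neg, Matrix.neg_apply]
  ring_nf

/-- The matrix `U' = (0 -1; 1 -1) ∈ SL₂(ℤ)` (`M U' = (b, -a-b; d, -c-d)` for `M = (a b; c d)`). [folklore] -/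
def slU' : SL(2, ℤ) := ⟨!![0, -1; 1, -1], by rw [Matrix.det_fin_two_of]; norm_num⟩

/-- **`T₁ − T₂` cancels on every right coset** (`T₂ = T₁ U`): on `diag(a, am) SL₂(ℤ)`,
`∑_γ sgnNorm T₂ = ∑_γ sgnNorm T₁` (reindex by `γ ↦ γ U'`). [cite: PopaZagier2017, Thm. 4(b) (proof)] -/
theorem finsum_sgnNorm_wT2_eq (a m : ℤ) :
    ∑ᶠ γ : SL(2, ℤ), cosetW (sgnNorm wT2) a m 1 γ = ∑ᶠ γ : SL(2, ℤ), cosetW (sgnNorm wT1) a m 1 γ := by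
  rw [← finsum_comp_equiv (Equiv.mulRight slU') (f := cosetW (sgnNorm wT1) a m 1)]
  refine finsum_congr fun γ => ?_
  simp only [cosetW, one_mul, Equiv.coe_mulRight, Matrix.SpecialLinearGroup.coe_mul, propT2]
  congr 1 <;> simp [slU', Matrix.mul_apply, Fin.sum_univ_two] <;> ring

/-- **`∑_γ (T₃ + T₄)(diag(a, am) γ) = 12`** (i.e. total weight `1`).
[cite: PopaZagier2017, Thm. 4(b) (proof)] -/
theorem finsum_wT3_add_wT4 (ha : 0 < a) (hm : 0 < m) :
    ∑ᶠ γ : SL(2, ℤ), (cosetW wT3 a m 1 γ + cosetW wT4 a m 1 γ) = 12 := by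
  classical
  let γ₁ : SL(2, ℤ) := ⟨!![0, -1; 1, 0], by rw [Matrix.det_fin_two_of]; norm_num⟩
  let γ₂ : SL(2, ℤ) := ⟨!![1, -1; 1, 0], by rw [Matrix.det_fin_two_of]; norm_num⟩
  let γ₃ : SL(2, ℤ) := ⟨!![0, -1; 1, -1], by rw [Matrix.det_fin_two_of]; norm_num⟩
  have h12 : γ₁ ≠ γ₂ := fun h => by
    have := congrArg (fun γ : SL(2, ℤ) => (γ : Mat) 0 0) h; simp [γ₁, γ₂] at this
  have h13 : γ₁ ≠ γ₃ := fun h => by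
    have := congrArg (fun γ : SL(2, ℤ) => (γ : Mat) 1 1) h; simp [γ₁, γ₃] at this
  have h23 : γ₂ ≠ γ₃ := fun h => by
    have := congrArg (fun γ : SL(2, ℤ) => (γ : Mat) 0 0) h; simp [γ₂, γ₃] at this
  have hsupp : (Function.support fun γ : SL(2, ℤ) => cosetW wT3 a m 1 γ + cosetW wT4 a m 1 γ) ⊆
      (({γ₁, γ₂, γ₃} : Finset SL(2, ℤ)) : Set SL(2, ℤ)) := by
    intro γ hγ
    rw [Function.mem_support] at hγ
    have h : cosetW wT3 a m 1 γ ≠ 0 ∨ cosetW wT4 a m 1 γ ≠ 0 := by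
      by_contra h'; push Not at h'; exact hγ (by rw [h'.1, h'.2, add_zero])
    simp only [cosetW, one_mul] at h
    have hdet := γ.det_coe
    rw [Matrix.det_fin_two] at hdet
    rcases T34_support (x := (γ : Mat) 0 0) (y := (γ : Mat) 0 1) (z := (γ : Mat) 1 0) (w := (γ : Mat) 1 1)
      ha hm hdet h with ⟨h0, h1, h2, h3⟩ | ⟨h0, h1, h2, h3⟩ | ⟨h0, h1, h2, h3⟩
    · have : γ = γ₁ := Subtype.ext (by ext i j; fin_cases i <;> fin_cases j <;> simp [γ₁, h0, h1, h2, h3])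
      simp [this]
    · have : γ = γ₂ := Subtype.ext (by ext i j; fin_cases i <;> fin_cases j <;> simp [γ₂, h0, h1, h2, h3])
      simp [this]
    · have : γ = γ₃ := Subtype.ext (by ext i j; fin_cases i <;> fin_cases j <;> simp [γ₃, h0, h1, h2, h3])
      simp [this]
  rw [finsum_eq_sum_of_support_subset _ hsupp, Finset.sum_insert (by simp [h12, h13]),
    Finset.sum_insert (by simp [h23]), Finset.sum_singleton]
  simp only [cosetW, one_mul, γ₁, γ₂, γ₃]
  simp only [Matrix.of_apply, Matrix.cons_val', Matrix.cons_val_zero,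
    Matrix.cons_val_one, Matrix.cons_val_fin_one, Matrix.empty_val', mul_zero, mul_one, mul_neg]
  rcases eq_or_lt_of_le (show 1 ≤ m by omega) with hm1 | hm2
  · subst hm1
    obtain ⟨v1, v2, v3, v4, v5, v6⟩ := T34_values_one ha
    simp only [mul_one] at *
    rw [v1, v2, v3, v4, v5, v6]; norm_num
  · have hk : a < a * m := by nlinarith
    obtain ⟨v1, v2, v3, v4, v5, v6⟩ := T34_values_two ha hk
    rw [v1, v2, v3, v4, v5, v6]; norm_num

end Evaluation

/-! ### Assembly of Theorem 4 (b) on the coset `diag(a, am) SL₂(ℤ)` -/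

section CosetValue

variable {a m : ℤ}

/-- Lemma-4(a) bounds for a sign-normalised bracket. [folklore] -/
theorem bounds_of_sgnNorm {w : ℤ → ℤ → ℤ → ℤ → ℤ}
    (hw : ∀ p q r s, w p q r s ≠ 0 →
      0 < p * s - q * r ∧ |p| ≤ p * s - q * r ∧ |q| ≤ p * s - q * r ∧ |r| ≤ p * s - q * r ∧ |s| ≤ p * s - q * r)
    (p q r s : ℤ) (h : sgnNorm w p q r s ≠ 0) :
    0 < p * s - q * r ∧ |p| ≤ p * s - q * r ∧ |q| ≤ p * s - q * r ∧ |r| ≤ p * s - q * r ∧ |s| ≤ p * s - q * r := by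
  unfold sgnNorm at h
  split_ifs at h
  · exact hw _ _ _ _ h
  · have h' := hw _ _ _ _ h
    simp only [abs_neg, neg_mul_neg] at h'
    exact h'

/-- `cosetW` of a sum of weights. [folklore] -/
theorem cosetW_add (w w' : ℤ → ℤ → ℤ → ℤ → ℤ) (a m ε : ℤ) (γ : SL(2, ℤ)) :
    cosetW (fun p q r s => w p q r s + w' p q r s) a m ε γ = cosetW w a m ε γ + cosetW w' a m ε γ := rfl

/-- `sgnNorm w` on the coset as `w(M) + w(−M)`. [folklore] -/
theorem cosetW_sgnNorm {w : ℤ → ℤ → ℤ → ℤ → ℤ} (hw : ∀ a b c d, w a b c d ≠ 0 → (0 < c ∨ (c = 0 ∧ 0 < a)))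
    (a m : ℤ) (γ : SL(2, ℤ)) :
    cosetW (sgnNorm w) a m 1 γ = cosetW w a m 1 γ + cosetW w a m (-1) γ := by
  simp only [cosetW, sgnNorm_eq_add hw, one_mul, neg_one_mul]

/-- `coeff12` on the coset as `pz13(M) + pz13(−M)`. [folklore] -/
theorem cosetW_coeff12 (a m : ℤ) (γ : SL(2, ℤ)) :
    cosetW coeff12 a m 1 γ = cosetW pz13 a m 1 γ + cosetW pz13 a m (-1) γ := by
  simp only [cosetW, coeff12_eq_pz13_add, one_mul, neg_one_mul]

/-- `pz13` on the coset as `T₁ − T₂ − T₃ − T₄`. [folklore] -/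
theorem cosetW_pz13 (a m ε : ℤ) (γ : SL(2, ℤ)) :
    cosetW pz13 a m ε γ = cosetW wT1 a m ε γ - cosetW wT2 a m ε γ - cosetW wT3 a m ε γ - cosetW wT4 a m ε γ := by
  simp only [cosetW, pz13_eq]

/-- **`∑_γ T₁(diag(a, am) γ) = ∑_γ T₂(diag(a, am) γ)`** (`T₂ = T₁ U` on right cosets).
[cite: PopaZagier2017, Thm. 4(b) (proof)] -/
theorem finsum_wT1_eq_finsum_wT2 (ha : 0 < a) (hm : 0 < m) :
    ∑ᶠ γ : SL(2, ℤ), cosetW wT1 a m 1 γ = ∑ᶠ γ : SL(2, ℤ), cosetW wT2 a m 1 γ := by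
  have h1 : ∑ᶠ γ : SL(2, ℤ), cosetW (sgnNorm wT1) a m 1 γ = 2 * ∑ᶠ γ : SL(2, ℤ), cosetW wT1 a m 1 γ := by
    rw [finsum_congr (cosetW_sgnNorm norm_of_wT1_ne_zero a m),
      finsum_add_distrib (finite_support_cosetW ha hm (fun _ _ _ _ h => bounds_of_wT1 h) (Or.inl rfl))
        (finite_support_cosetW ha hm (fun _ _ _ _ h => bounds_of_wT1 h) (Or.inr rfl)),
      finsum_cosetW_neg, two_mul]
  have h2 : ∑ᶠ γ : SL(2, ℤ), cosetW (sgnNorm wT2) a m 1 γ = 2 * ∑ᶠ γ : SL(2, ℤ), cosetW wT2 a m 1 γ := by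
    rw [finsum_congr (cosetW_sgnNorm norm_of_wT2_ne_zero a m),
      finsum_add_distrib (finite_support_cosetW ha hm (fun _ _ _ _ h => bounds_of_wT2 h) (Or.inl rfl))
        (finite_support_cosetW ha hm (fun _ _ _ _ h => bounds_of_wT2 h) (Or.inr rfl)),
      finsum_cosetW_neg, two_mul]
  have h3 := finsum_sgnNorm_wT2_eq a m
  rw [h1, h2] at h3
  linarith

/-- **Theorem 4 (b) on the coset, integer form**: `∑_γ coeff12(diag(a, am) γ) = −24`.
[cite: PopaZagier2017, Thm. 4(b)] -/
theorem finsum_cosetW_coeff12 (ha : 0 < a) (hm : 0 < m) :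
    ∑ᶠ γ : SL(2, ℤ), cosetW coeff12 a m 1 γ = -24 := by
  have hf1 : ∀ {ε : ℤ}, ε = 1 ∨ ε = -1 → (Function.support (cosetW wT1 a m ε)).Finite := fun hε =>
    finite_support_cosetW ha hm (fun _ _ _ _ h => bounds_of_wT1 h) hε
  have hf2 : ∀ {ε : ℤ}, ε = 1 ∨ ε = -1 → (Function.support (cosetW wT2 a m ε)).Finite := fun hε =>
    finite_support_cosetW ha hm (fun _ _ _ _ h => bounds_of_wT2 h) hε
  have hf3 : ∀ {ε : ℤ}, ε = 1 ∨ ε = -1 → (Function.support (cosetW wT3 a m ε)).Finite := fun hε =>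
    finite_support_cosetW ha hm (fun _ _ _ _ h => bounds_of_wT3 h) hε
  have hf4 : ∀ {ε : ℤ}, ε = 1 ∨ ε = -1 → (Function.support (cosetW wT4 a m ε)).Finite := fun hε =>
    finite_support_cosetW ha hm (fun _ _ _ _ h => bounds_of_wT4 h) hε
  have hfp : ∀ {ε : ℤ}, ε = 1 ∨ ε = -1 → (Function.support (cosetW pz13 a m ε)).Finite := fun hε =>
    finite_support_cosetW ha hm (fun _ _ _ _ h => bounds_of_pz13 h) hε
  -- `∑ pz13 = ∑ T₁ − ∑ T₂ − ∑ (T₃ + T₄) = −12`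
  have hpz : ∑ᶠ γ : SL(2, ℤ), cosetW pz13 a m 1 γ = -12 := by
    have e : ∀ γ, cosetW pz13 a m 1 γ =
        (cosetW wT1 a m 1 γ - cosetW wT2 a m 1 γ) - (cosetW wT3 a m 1 γ + cosetW wT4 a m 1 γ) := fun γ => by
      rw [cosetW_pz13]; ring
    rw [finsum_congr e, finsum_sub_distrib, finsum_sub_distrib (hf1 (Or.inl rfl)) (hf2 (Or.inl rfl)),
      finsum_wT1_eq_finsum_wT2 ha hm, sub_self, finsum_wT3_add_wT4 ha hm]
    · norm_num
    · exact ((hf1 (Or.inl rfl)).union (hf2 (Or.inl rfl))).subset (Function.support_sub _ _)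
    · exact ((hf3 (Or.inl rfl)).union (hf4 (Or.inl rfl))).subset (Function.support_add _ _)
  rw [finsum_congr (cosetW_coeff12 a m), finsum_add_distrib (hfp (Or.inl rfl)) (hfp (Or.inr rfl)),
    finsum_cosetW_neg, hpz]
  norm_num

/-- **Theorem 4 (b)**: `⟨T̃_n, diag(a, am) Γ⟩ = −1`, i.e. `cosetSum (coeffN n) diag(a, am) = −2`
(`coeffN` counts `±M` twice). [cite: PopaZagier2017, Thm. 4(b)] -/
theorem cosetSum_coeffN_diag {n : ℤ} (ha : 0 < a) (hm : 0 < m) (hn : a * (a * m) = n) :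
    cosetSum (coeffN n) !![a, 0; 0, a * m] = -2 := by
  have hval : ∀ γ : SL(2, ℤ), coeffN n (!![a, 0; 0, a * m] * (γ : Mat)) =
      ((cosetW coeff12 a m 1 γ : ℤ) : ℚ) / 12 := fun γ => by
    have hdet : (!![a, 0; 0, a * m] * (γ : Mat)).det = n := by
      rw [Matrix.det_mul, Matrix.SpecialLinearGroup.det_coe, mul_one, Matrix.det_fin_two_of, ← hn]; ring
    rw [coeffN, if_pos hdet, coeff_eq, cosetW]
    congr 3 <;> simp [Matrix.mul_apply, Fin.sum_univ_two]
  unfold cosetSum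
  rw [finsum_congr hval]
  have hfin : (Function.support fun γ : SL(2, ℤ) => ((cosetW coeff12 a m 1 γ : ℤ) : ℚ)).Finite := by
    refine (finite_support_cosetW ha hm (fun _ _ _ _ h => coeff12_bounds h) (Or.inl rfl)).subset ?_
    intro γ hγ
    simpa using hγ
  rw [show (fun γ : SL(2, ℤ) => ((cosetW coeff12 a m 1 γ : ℤ) : ℚ) / 12) =
      fun γ : SL(2, ℤ) => ((cosetW coeff12 a m 1 γ : ℤ) : ℚ) * (1 / 12) by funext γ; ring,
    ← finsum_mul' _ _ hfin,
    show (∑ᶠ γ : SL(2, ℤ), ((cosetW coeff12 a m 1 γ : ℤ) : ℚ)) = ((∑ᶠ γ : SL(2, ℤ), cosetW coeff12 a m 1 γ : ℤ) : ℚ)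
      from ((Int.castAddHom ℚ).map_finsum
        (finite_support_cosetW ha hm (fun _ _ _ _ h => coeff12_bounds h) (Or.inl rfl))).symm,
    finsum_cosetW_coeff12 ha hm]
  norm_num

end CosetValue

/-! ### Theorem 1 (i): all right-coset sums, and `∑_M c(M) = −σ₁(n)` -/

section Total

variable {n : ℤ}

/-- **Theorem 1 (i)**: `⟨T̃_n, K⟩ = −1` for every right coset `K = M₀ SL₂(ℤ)` of determinant `n`
(as `cosetSum (coeffN n) M₀ = −2`). [cite: PopaZagier2017, Thm. 1 (i)] -/
theorem cosetSum_coeffN (hn : 0 < n) {M₀ : Mat} (hM : M₀.det = n) : cosetSum (coeffN n) M₀ = -2 := by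
  obtain ⟨γ, γ', a, m, ha, hm, hγ⟩ := exists_SL_mul_diag_mul_SL hn hM
  have hdet : a * (a * m) = n := by
    have := congrArg Matrix.det hγ
    rw [hM, Matrix.det_mul, Matrix.det_mul, Matrix.SpecialLinearGroup.det_coe,
      Matrix.SpecialLinearGroup.det_coe, one_mul, mul_one, Matrix.det_fin_two_of] at this
    rw [this]; ring
  rw [hγ, cosetSum_mul_coe, cosetSum_coe_mul (heckeHyp_coeffN n) hn.ne', cosetSum_coeffN_diag ha hm hdet]

/-- The Hermite representative of the right coset of `M` (through the transpose): for `det M = n`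
the unique `C ∈ R_n` with `M ∈ Cᵀ SL₂(ℤ)`. [folklore] -/
def rightRep (hn : 0 < n) (M : Mat) : Mat :=
  if h : M.det = n then
    (exists_SL_mul_mem_hermiteReps hn Mᵀ (by rw [Matrix.det_transpose, h])).choose.2
  else 0

/-- Defining property of `rightRep`: `C ∈ R_n` and `M = Cᵀ hᵀ` for some `h ∈ SL₂(ℤ)`. [folklore] -/
theorem rightRep_spec (hn : 0 < n) {M : Mat} (hM : M.det = n) :
    rightRep hn M ∈ hermiteReps n ∧ ∃ h : SL(2, ℤ), M = (rightRep hn M)ᵀ * (h : Mat) := by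
  rw [rightRep, dif_pos hM]
  set ex := exists_SL_mul_mem_hermiteReps hn Mᵀ (by rw [Matrix.det_transpose, hM])
  obtain ⟨hmem, hmul⟩ := ex.choose_spec
  refine ⟨hmem, ⟨Matrix.SpecialLinearGroup.transpose ex.choose.1, ?_⟩⟩
  rw [Matrix.SpecialLinearGroup.transpose, Matrix.SpecialLinearGroup.coe_mk, ← Matrix.transpose_mul, hmul,
    Matrix.transpose_transpose]

/-- Uniqueness: `rightRep (Cᵀ γ) = C` for `C ∈ R_n`, `γ ∈ SL₂(ℤ)`. [folklore] -/
theorem rightRep_transpose_mul (hn : 0 < n) {C : Mat} (hC : C ∈ hermiteReps n) (γ : SL(2, ℤ)) :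
    rightRep hn (Cᵀ * (γ : Mat)) = C := by
  have hdet : (Cᵀ * (γ : Mat)).det = n := by
    rw [Matrix.det_mul, Matrix.det_transpose, det_of_mem_hermiteReps hn hC, Matrix.SpecialLinearGroup.det_coe,
      mul_one]
  obtain ⟨hmem, h, hh⟩ := rightRep_spec hn hdet
  -- `Cᵀ γ = C'ᵀ h`, so `γᵀ C = hᵀ C'` and `C' = C` by uniqueness of Hermite representatives
  have ht := congrArg Matrix.transpose hh
  rw [Matrix.transpose_mul, Matrix.transpose_transpose, Matrix.transpose_mul, Matrix.transpose_transpose] at ht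
  symm
  refine eq_of_SL_mul_mem_hermiteReps hn hC hmem
    ((Matrix.SpecialLinearGroup.transpose h)⁻¹ * Matrix.SpecialLinearGroup.transpose γ) ?_
  rw [Matrix.SpecialLinearGroup.coe_mul, Matrix.mul_assoc,
    show ((Matrix.SpecialLinearGroup.transpose γ : SL(2, ℤ)) : Mat) * C = (γ : Mat)ᵀ * C from rfl, ht,
    ← Matrix.mul_assoc, show ((h : Mat))ᵀ = ((Matrix.SpecialLinearGroup.transpose h : SL(2, ℤ)) : Mat) from rfl,
    ← Matrix.SpecialLinearGroup.coe_mul, inv_mul_cancel, Matrix.SpecialLinearGroup.coe_one, Matrix.one_mul]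

/-- **Decomposition of `∑_M ξ(M)` into right-coset sums**: for `ξ` finitely supported on
determinant `n > 0`, `∑_M ξ(M) = ∑_{C ∈ R_n} ⟨ξ, Cᵀ Γ⟩`. [folklore] -/
theorem finsum_eq_sum_cosetSum (hn : 0 < n) {ξ : Mat → ℚ} (hH : HeckeHyp n ξ) :
    ∑ᶠ M, ξ M = ∑ C ∈ hermiteReps n, cosetSum ξ Cᵀ := by
  classical
  set s := hH.finite.toFinset with hs
  have hsub : Function.support ξ ⊆ s := by rw [hs, Set.Finite.coe_toFinset]
  set s' := s.filter fun M => M.det = n with hs'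
  have hsub' : Function.support ξ ⊆ s' := fun M hM => by
    rw [hs', Finset.coe_filter]
    exact ⟨hsub hM, hH.det_eq M hM⟩
  rw [finsum_eq_sum_of_support_subset _ hsub']
  -- fibre decomposition along `rightRep`
  have hmaps : ∀ M ∈ s', rightRep hn M ∈ hermiteReps n := fun M hM =>
    (rightRep_spec hn (Finset.mem_filter.mp hM).2).1
  rw [← Finset.sum_fiberwise_of_maps_to hmaps]
  refine Finset.sum_congr rfl fun C hC => ?_
  -- the fibre over `C` is the right coset `Cᵀ SL₂(ℤ)`
  unfold cosetSum
  rw [finsum_eq_sum_of_support_subset _ (s := (finite_support_cosetFun hH hn.ne' Cᵀ).toFinset)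
    (by rw [Set.Finite.coe_toFinset])]
  symm
  refine Finset.sum_bij_ne_zero (fun γ _ _ => Cᵀ * (γ : Mat)) (fun γ _ hγ => ?_) (fun γ₁ _ _ γ₂ _ _ h => ?_)
    (fun M hM hM0 => ?_) (fun γ _ _ => rfl)
  · rw [Finset.mem_filter]
    exact ⟨Finset.mem_coe.mp (hsub' hγ), rightRep_transpose_mul hn hC γ⟩
  · exact mul_coe_injective (M₀ := Cᵀ) (by
      rw [Matrix.det_transpose, det_of_mem_hermiteReps hn hC]; exact hn.ne') h
  · obtain ⟨hMs', hMC⟩ := Finset.mem_filter.mp hM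
    have hMdet : M.det = n := (Finset.mem_filter.mp hMs').2
    obtain ⟨-, h, hh⟩ := rightRep_spec hn hMdet
    rw [hMC] at hh
    refine ⟨h, ?_, by rw [← hh]; exact hM0, hh.symm⟩
    rw [Set.Finite.mem_toFinset, Function.mem_support, ← hh]
    exact hM0

/-- **Theorem 1 (i), summed**: `∑_M coeffN n M = −2 σ₁(n)` (`#(M_n/Γ) = #R_n = σ₁(n)`; Popa–Zagier:
`⟨T̃_n, M_n⟩ = −σ₁(n)` with `±M` identified). [cite: PopaZagier2017, Thm. 1 (i), Cor. 1] -/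
theorem finsum_coeffN {n : ℕ} (hn : 0 < n) :
    ∑ᶠ M, coeffN n M = -2 * ((n.divisors.sum id : ℕ) : ℚ) := by
  have hn' : (0 : ℤ) < n := by exact_mod_cast hn
  rw [finsum_eq_sum_cosetSum hn' (heckeHyp_coeffN n),
    Finset.sum_congr rfl fun C hC => cosetSum_coeffN hn'
      (by rw [Matrix.det_transpose, det_of_mem_hermiteReps hn' hC]),
    Finset.sum_const, card_hermiteReps hn, nsmul_eq_mul]
  ring

end Total

end Literature.NumberTheory.EllipticCurves.ModularForms

end
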